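import Literature.NumberTheory.Sieve.ChenTwinUpperB
import Literature.NumberTheory.Sieve.ChenSiftedLower
import Literature.NumberTheory.Sieve.ChenSwitchingLinearSieve
import HarnessLib

/-!
# Chen's theorem: the sieve step of the switching bound (Nathanson, Thm 10.6) for `N = p + P₂`

Topic `Literature/NumberTheory/Sieve`; companion of `ChenTheorem.lean` (the architecture of the
printed proof of Chen's theorem, Nathanson, *Additive Number Theory: The Classical Bases*, GTM 164,
Ch. 10, as named facts). This file carries out, for the GOLDBACH sequence `B = {N − p₁p₂p₃}` of
§10.2, the first of the three steps of the proof of Theorem 10.6 (pp. 288–289 of the book), exactly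
as `ChenTwinUpperB.lean` does for the twin sequence `{p₁p₂p₃ − 2}`:

1. (**the sieve step**, this file) enlarge `B` to `B̃ = ⋃_ℓ B^{(ℓ)}` over the grid
   `ℓ = z(1+ε)^k` ((10.12)–(10.14): `ℓ ≤ p₁ < (1+ε)ℓ`, the condition `p₁p₂p₃ < N` relaxed to
   `ℓ p₂p₃ < N`, the condition `(p₁, N) = 1` KEPT — Nathanson drops it; keeping it only shrinks
   `B̃` and makes the remainders vanish at the moduli not coprime to `N`), apply the linear sieve
   upper bound at level `D = N^{1/2−δ}` (`s = log D/log y = 3(1/2 − δ) ≤ 3/2`,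
   `F(s) = 2e^γ/s`) and `V(y)/V(z) ≤ (3/8)(1 + o(1))`:
   `S(B, 𝒫, y) ≤ (e^γ/(2(1−2δ)) + θ) · #T̃(N, ε) · V(z) + R(N, ε, N^{1/2−δ})` for large even `N`
   (`switchedSiftedCount_le`);
2. (the remainder, (10.15) from Thm 10.7) and
3. (the cardinality `#T̃ ≤ (1 + O(ε)) cN/log N`, p. 290)
are proved in the sequel files; here they enter nowhere.

The sieve theorem used is the UNIFORM linear-sieve upper bound PROVED in the tree
(`LinearSieve.upper_explicit` of `ChenSwitchingLinearSieve.lean`, from Iwaniec's Theorem 1,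
`Iwaniec1980_thm1_upper_of_half_lt`, with `F₁(s) = 2e^γ/s` on `(0, 3]`), applicable because the
Goldbach density `g = shiftedPrimesDensity N` has dimension `Ω(1, L₀)` uniformly in even `N`
(`hasIwaniecDimension_shiftedPrimesDensity`).

## Dictionary

* `switchedTriplesExt N ε` = `T̃(N, ε)`: triples of primes `(p₁, p₂, p₃)` with
  `z ≤ p₁ < y ≤ p₂ ≤ p₃` (`z = N^{1/8}`, `y = N^{1/3}`, as reals), `p₁ ∤ N`, `(p₂p₃, N) = 1`,
  `ℓ(p₁) p₂p₃ < N`, `ℓ(p) = chenGridPoint N ε p = z(1+ε)^{⌊log(p/z)/log(1+ε)⌋}` (the grid of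
  `ChenTwinUpperB.lean`);
* the sifted sequence `switchedSeqExt N ε`: weights `a(n) = #{t ∈ T̃ : |N − p₁p₂p₃| = n}`
  (elements of `B̃` may be NEGATIVE, `N ≤ p₁p₂p₃ < (1+ε)N`; the sieve only sees `|N − p₁p₂p₃|`,
  and `d ∣ |N − p₁p₂p₃| ⟺ p₁p₂p₃ ≡ N (mod d)`), size `#T̃`, density `shiftedPrimesDensity N`,
  height `N` (`1 ≤ |N − p₁p₂p₃| ≤ N`);
* `switchedRemainderExt N ε D = ∑_{d < D, d ∣ P(y)} |#{t ∈ T̃ : d ∣ |N − p₁p₂p₃|} − g(d) #T̃|`.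

## References

* M. B. Nathanson, *Additive Number Theory: The Classical Bases*, GTM 164 (1996), Thm 10.6 and
  its proof, pp. 288–289; (10.12)–(10.15). [Nathanson1996]
* H. Iwaniec, *Rosser's sieve*, Acta Arith. 36 (1980), 171–202, Theorem 1. [IwaniecActaArith1980]
-/

open Finset Filter Topology

noncomputable section

namespace Literature.NumberTheory.Sieve.Chen

open SieveSequence

/-! ### The enlarged set of triples `T̃(N, ε)` -/

/-- The enlarged index set `T̃(N, ε)` of Chen's switched set `B` (Nathanson (10.13)–(10.14), with
the coprimality `(p₁, N) = 1` kept): triples of primes `(p₁, p₂, p₃)`, all `< N`, with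
`N^{1/8} ≤ p₁ < N^{1/3} ≤ p₂ ≤ p₃`, `p₁ ∤ N`, `(p₂p₃, N) = 1` and `ℓ(p₁) p₂ p₃ < N`.
[cite: Nathanson1996, Thm 10.6 (proof, (10.13)–(10.14))] -/
def switchedTriplesExt (N : ℕ) (ε : ℝ) : Finset (ℕ × ℕ × ℕ) :=
  (Finset.range N ×ˢ Finset.range N ×ˢ Finset.range N).filter fun t : ℕ × ℕ × ℕ =>
    t.1.Prime ∧ t.2.1.Prime ∧ t.2.2.Prime ∧ z N ≤ (t.1 : ℝ) ∧ (t.1 : ℝ) < y N ∧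
      y N ≤ (t.2.1 : ℝ) ∧ t.2.1 ≤ t.2.2 ∧ ¬t.1 ∣ N ∧ (t.2.1 * t.2.2).Coprime N ∧
        chenGridPoint N ε t.1 * t.2.1 * t.2.2 < (N : ℝ)

/-- Membership in `T̃(N, ε)`. [folklore] -/
theorem mem_switchedTriplesExt {N : ℕ} {ε : ℝ} {t : ℕ × ℕ × ℕ} :
    t ∈ switchedTriplesExt N ε ↔ (t.1 < N ∧ t.2.1 < N ∧ t.2.2 < N) ∧
      t.1.Prime ∧ t.2.1.Prime ∧ t.2.2.Prime ∧ z N ≤ (t.1 : ℝ) ∧ (t.1 : ℝ) < y N ∧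
      y N ≤ (t.2.1 : ℝ) ∧ t.2.1 ≤ t.2.2 ∧ ¬t.1 ∣ N ∧ (t.2.1 * t.2.2).Coprime N ∧
        chenGridPoint N ε t.1 * t.2.1 * t.2.2 < (N : ℝ) := by
  simp only [switchedTriplesExt, Finset.mem_filter, Finset.mem_product, Finset.mem_range]

/-- The distance `|N − p₁p₂p₃|` of a triple. [folklore] -/
def tripleDist (N : ℕ) (t : ℕ × ℕ × ℕ) : ℕ := Int.natAbs ((N : ℤ) - t.1 * t.2.1 * t.2.2)

/-- For `t = (p₁, p₂, p₃) ∈ T̃(N, ε)` (`0 < ε ≤ 1`): `p₁p₂p₃ < 2N`, `p₁p₂p₃ ≠ N`, hence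
`1 ≤ |N − p₁p₂p₃| ≤ N` (as `p₁ < (1+ε)ℓ(p₁) ≤ 2ℓ(p₁)`, `ℓ(p₁)p₂p₃ < N`, and `(p₂p₃, N) = 1`).
[folklore] -/
theorem tripleDist_pos_and_le {N : ℕ} {ε : ℝ} (hε : 0 < ε) (hε1 : ε ≤ 1)
    {t : ℕ × ℕ × ℕ} (ht : t ∈ switchedTriplesExt N ε) :
    1 ≤ tripleDist N t ∧ tripleDist N t ≤ N := by
  obtain ⟨⟨hN1, -, -⟩, h₁, h₂, h₃, hz, -, -, -, -, hcop, hlt⟩ := mem_switchedTriplesExt.mp ht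
  have hNpos : 0 < N := by omega
  -- `p₁p₂p₃ < 2N`
  have hp : (N : ℝ) ^ (1 / 8 : ℝ) ≤ t.1 := hz
  have hltg := lt_mul_chenGridPoint hNpos hε hp
  have hℓ := chenGridPoint_pos hNpos hε t.1
  have h23 : (0 : ℝ) < (t.2.1 : ℝ) * t.2.2 := by
    have := h₂.pos; have := h₃.pos; positivity
  have h2N : t.1 * t.2.1 * t.2.2 < 2 * N := by
    have hreal : ((t.1 * t.2.1 * t.2.2 : ℕ) : ℝ) < 2 * N := by
      push_cast
      calc (t.1 : ℝ) * t.2.1 * t.2.2 = (t.1 : ℝ) * ((t.2.1 : ℝ) * t.2.2) := by ring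
        _ < (1 + ε) * chenGridPoint N ε t.1 * ((t.2.1 : ℝ) * t.2.2) := by gcongr
        _ ≤ 2 * chenGridPoint N ε t.1 * ((t.2.1 : ℝ) * t.2.2) := by gcongr; linarith
        _ = 2 * (chenGridPoint N ε t.1 * t.2.1 * t.2.2) := by ring
        _ ≤ 2 * N := by linarith
    exact_mod_cast hreal
  -- `p₁p₂p₃ ≠ N`
  have hne : t.1 * t.2.1 * t.2.2 ≠ N := by
    intro h
    have hdvd : t.2.1 * t.2.2 ∣ N := ⟨t.1, by rw [← h]; ring⟩
    have h1 : t.2.1 * t.2.2 = 1 := Nat.Coprime.eq_one_of_dvd hcop hdvd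
    have := h₂.two_le
    have := h₃.two_le
    nlinarith
  unfold tripleDist
  constructor
  · rw [Nat.one_le_iff_ne_zero, Ne, Int.natAbs_eq_zero, sub_eq_zero]
    intro h
    exact hne (by exact_mod_cast h.symm)
  · have key : ((((N : ℤ) - t.1 * t.2.1 * t.2.2).natAbs : ℕ) : ℤ) ≤ N := by
      rw [Int.natCast_natAbs, abs_le]
      have h2N' : ((t.1 * t.2.1 * t.2.2 : ℕ) : ℤ) < 2 * N := by exact_mod_cast h2N
      push_cast at h2N'
      constructor
      · linarith
      · have : (0 : ℤ) ≤ (t.1 : ℤ) * t.2.1 * t.2.2 := by positivity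
        linarith
    exact_mod_cast key

/-- `d ∣ |N − p₁p₂p₃| ⟺ p₁p₂p₃ ≡ N (mod d)`. [folklore] -/
theorem dvd_tripleDist_iff (N d : ℕ) (t : ℕ × ℕ × ℕ) :
    d ∣ tripleDist N t ↔ ((t.1 * t.2.1 * t.2.2 : ℕ) : ZMod d) = (N : ZMod d) := by
  unfold tripleDist
  rw [← Int.natCast_dvd_natCast, Int.natCast_natAbs, dvd_abs,
    ← Int.cast_natCast (R := ZMod d) (t.1 * t.2.1 * t.2.2), ← Int.cast_natCast (R := ZMod d) N,
    ZMod.intCast_eq_intCast_iff_dvd_sub]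
  push_cast
  exact Iff.rfl

/-! ### The sifted sequence carried by `T̃(N, ε)` -/

/-- The weights of the enlarged switched sequence: `a(n) = #{t ∈ T̃(N, ε) : |N − p₁p₂p₃| = n}`.
[cite: Nathanson1996, Thm 10.6 (proof)] -/
def switchedWeightExt (N : ℕ) (ε : ℝ) (n : ℕ) : ℝ :=
  #((switchedTriplesExt N ε).filter fun t : ℕ × ℕ × ℕ => tripleDist N t = n)

/-- **The enlarged switched sequence** as a sifted sequence: weights `switchedWeightExt`,
density `g = shiftedPrimesDensity N` (`1/φ(d)` for `(d, N) = 1`, else `0`), size `#T̃(N, ε)`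
(Nathanson p. 288: "`g(d) = g_n(d) = 1/φ(d)`", `|B^{(ℓ)}_d| = |B^{(ℓ)}|/φ(d) + r_d^{(ℓ)}`).
[cite: Nathanson1996, Thm 10.6 (proof)] -/
def switchedSeqExt (N : ℕ) (ε : ℝ) : SieveSequence where
  a := switchedWeightExt N ε
  a_nonneg := fun _ => Nat.cast_nonneg _
  size := fun _ => #(switchedTriplesExt N ε)
  density := shiftedPrimesDensity N
  density_mult := isMultiplicative_shiftedPrimesDensity N

/-- The remainder of the enlarged switched sequence up to level `D`, sifting primes `< y`:
`R(N, ε, D) = ∑_{d < D, d ∣ P(y)} |#{t ∈ T̃ : d ∣ |N − p₁p₂p₃|} − g(d) · #T̃|`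
(Nathanson's `∑_ℓ R^{(ℓ)}` dominates it, (10.15)). [cite: Nathanson1996, Thm 10.6 (proof, (10.15))] -/
def switchedRemainderExt (N : ℕ) (ε D : ℝ) : ℝ :=
  ∑ d ∈ (Finset.range ⌈D⌉₊).filter (· ∣ primesProdBelow (y N)),
    |(#((switchedTriplesExt N ε).filter fun t : ℕ × ℕ × ℕ => d ∣ tripleDist N t) : ℝ) -
      shiftedPrimesDensity N d * #(switchedTriplesExt N ε)|

/-- `R(N, ε, D) ≥ 0`. [folklore] -/
theorem switchedRemainderExt_nonneg (N : ℕ) (ε D : ℝ) : 0 ≤ switchedRemainderExt N ε D :=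
  Finset.sum_nonneg fun _ _ => abs_nonneg _

/-- `∑_{n ∈ S} a(n) = #{t ∈ T̃ : |N − p₁p₂p₃| ∈ S}`. [folklore] -/
theorem sum_switchedWeightExt_eq (N : ℕ) (ε : ℝ) (S : Finset ℕ) :
    ∑ n ∈ S, switchedWeightExt N ε n =
      #((switchedTriplesExt N ε).filter fun t : ℕ × ℕ × ℕ => tripleDist N t ∈ S) := by
  unfold switchedWeightExt
  exact sum_card_filter_eq_card_filter_mem _ _ _

/-- `S(𝒜̃, P; N) = #{t ∈ T̃ : (|N − p₁p₂p₃|, P) = 1}` (every `|N − p₁p₂p₃|` lies in `(0, N]`).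
[folklore] -/
theorem sifted_switchedSeqExt_eq {N : ℕ} {ε : ℝ} (hε : 0 < ε) (hε1 : ε ≤ 1) (P : ℕ) :
    (switchedSeqExt N ε).sifted N P =
      #((switchedTriplesExt N ε).filter fun t : ℕ × ℕ × ℕ => (tripleDist N t).Coprime P) := by
  change ∑ n ∈ (Finset.Ioc 0 ⌊((N : ℕ) : ℝ)⌋₊).filter (fun n : ℕ => n.Coprime P),
    switchedWeightExt N ε n = _
  rw [Nat.floor_natCast, sum_switchedWeightExt_eq]
  congr 2
  refine Finset.filter_congr fun t ht => ?_
  have hb := tripleDist_pos_and_le hε hε1 ht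
  simp only [Finset.mem_filter, Finset.mem_Ioc]
  constructor
  · exact fun h => h.2
  · exact fun h => ⟨⟨by omega, hb.2⟩, h⟩

/-- `|𝒜̃_d|(N) = #{t ∈ T̃ : d ∣ |N − p₁p₂p₃|}`. [folklore] -/
theorem congrSum_switchedSeqExt_eq {N : ℕ} {ε : ℝ} (hε : 0 < ε) (hε1 : ε ≤ 1) (d : ℕ) :
    (switchedSeqExt N ε).congrSum d N =
      #((switchedTriplesExt N ε).filter fun t : ℕ × ℕ × ℕ => d ∣ tripleDist N t) := by
  change ∑ n ∈ (Finset.Ioc 0 ⌊((N : ℕ) : ℝ)⌋₊).filter (d ∣ ·), switchedWeightExt N ε n = _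
  rw [Nat.floor_natCast, sum_switchedWeightExt_eq]
  congr 2
  refine Finset.filter_congr fun t ht => ?_
  have hb := tripleDist_pos_and_le hε hε1 ht
  simp only [Finset.mem_filter, Finset.mem_Ioc]
  constructor
  · exact fun h => h.2
  · exact fun h => ⟨⟨by omega, hb.2⟩, h⟩

/-- The remainder sum of the sieve theorem for `𝒜̃` at height `N` is `R(N, ε, D)`. [folklore] -/
theorem sum_abs_remainder_switchedSeqExt_eq {N : ℕ} {ε : ℝ} (hε : 0 < ε) (hε1 : ε ≤ 1) (D : ℝ) :
    ∑ d ∈ (Finset.range ⌈D⌉₊).filter (· ∣ primesProdBelow (y N)),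
        |(switchedSeqExt N ε).remainder d N| = switchedRemainderExt N ε D := by
  unfold switchedRemainderExt
  refine Finset.sum_congr rfl fun d _ => ?_
  rw [SieveSequence.remainder, congrSum_switchedSeqExt_eq hε hε1]
  rfl

/-- `V(P(w))` for the density `shiftedPrimesDensity N` is Chen's `V(w) = ∏_{p<w, p∤N}(1 − 1/(p−1))`.
[cite: Nathanson1996, (10.8)] -/
theorem densityProduct_switchedSeqExt_eq (N : ℕ) (ε : ℝ) (w : ℝ) :
    (switchedSeqExt N ε).densityProduct (primesProdBelow w) = sieveProduct N w :=
  densityProduct_chenGoldbachSeq N w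

/-! ### From `B` to `T̃(N, ε)` -/

/-- **`S(B, 𝒫, y) ≤ S(𝒜̃, P(y); N)`** (Nathanson (10.14): `B ⊆ B̃`): the number of elements of
`B` without prime factors `q < y`, `q ∤ N`, is at most the number of triples `t ∈ T̃(N, ε)` with
`(|N − p₁p₂p₃|, P(y)) = 1` (an element `n = N − p₁p₂p₃` of `B` comes from the triple
`(p₁, p₂, p₃) ∈ T̃`, as `ℓ(p₁) ≤ p₁`; it is coprime to `N`, so free of ALL primes `< y`).
[cite: Nathanson1996, Thm 10.6 (proof, (10.14))] -/
theorem switchedSiftedCount_le_card {N : ℕ} {ε : ℝ} (hε : 0 < ε) :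
    switchedSiftedCount N (z N) (y N) ≤
      #((switchedTriplesExt N ε).filter fun t : ℕ × ℕ × ℕ =>
        (tripleDist N t).Coprime (primesProdBelow (y N))) := by
  classical
  unfold switchedSiftedCount
  refine le_trans (Finset.card_le_card (t := ((switchedTriplesExt N ε).filter
      fun t : ℕ × ℕ × ℕ => (tripleDist N t).Coprime (primesProdBelow (y N))).image
    fun t : ℕ × ℕ × ℕ => tripleDist N t) ?_) Finset.card_image_le
  intro n hn
  rw [Finset.mem_filter] at hn
  obtain ⟨hnB, hsift⟩ := hn
  rw [switchedSet, Finset.mem_filter] at hnB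
  obtain ⟨hnN, p₁, hp₁, p₂, hp₂, p₃, hp₃, hz, hy, hy', h23, hlt, hcop, hsum⟩ := hnB
  rw [Nat.mem_primesBelow] at hp₁ hp₂ hp₃
  have hNpos : 0 < N := by omega
  rw [Finset.mem_image]
  refine ⟨(p₁, p₂, p₃), ?_, ?_⟩
  · rw [Finset.mem_filter, mem_switchedTriplesExt]
    have hcop' := Nat.coprime_mul_iff_left.mp hcop
    have hcop1 : ¬p₁ ∣ N := (Nat.Prime.coprime_iff_not_dvd hp₁.2).mp
      (Nat.coprime_mul_iff_left.mp hcop'.1).1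
    have hcop23 : (p₂ * p₃).Coprime N := by
      rw [Nat.coprime_mul_iff_left]
      exact ⟨(Nat.coprime_mul_iff_left.mp hcop'.1).2, hcop'.2⟩
    have hgrid : chenGridPoint N ε p₁ * p₂ * p₃ < (N : ℝ) := by
      have hℓ := chenGridPoint_le hNpos hε hz
      have hℓ0 := (chenGridPoint_pos hNpos hε p₁).le
      calc chenGridPoint N ε p₁ * p₂ * p₃ ≤ (p₁ : ℝ) * p₂ * p₃ := by gcongr
        _ = ((p₁ * p₂ * p₃ : ℕ) : ℝ) := by push_cast; ring
        _ < N := by exact_mod_cast hlt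
    refine ⟨⟨⟨hp₁.1, hp₂.1, hp₃.1⟩, hp₁.2, hp₂.2, hp₃.2, hz, hy, hy', h23, hcop1, hcop23, hgrid⟩, ?_⟩
    -- coprimality with `P(y)`
    have hdist : tripleDist N (p₁, p₂, p₃) = n := by
      unfold tripleDist
      dsimp only
      have : (N : ℤ) - p₁ * p₂ * p₃ = n := by
        have h := congrArg (fun m : ℕ => (m : ℤ)) hsum
        push_cast at h
        linarith
      rw [this, Int.natAbs_natCast]
    rw [hdist, coprime_primesProdBelow_iff]
    intro q hq hqn
    have hqprime : q.Prime := Nat.prime_of_mem_primesBelow hq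
    by_cases hqN : q ∣ N
    · -- `q ∣ N`, `q ∣ n` ⇒ `q ∣ p₁p₂p₃`, contradicting `(p₁p₂p₃, N) = 1`
      have hqP : q ∣ p₁ * p₂ * p₃ := by
        have : q ∣ p₁ * p₂ * p₃ + n := by rw [hsum]; exact hqN
        exact (Nat.dvd_add_left hqn).mp this
      have hg : q ∣ Nat.gcd (p₁ * p₂ * p₃) N := Nat.dvd_gcd hqP hqN
      rw [hcop.gcd_eq_one] at hg
      exact absurd (Nat.dvd_one.mp hg) hqprime.one_lt.ne'
    · exact hsift q hq hqN hqn
  · unfold tripleDist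
    dsimp only
    have : (N : ℤ) - p₁ * p₂ * p₃ = n := by
      have h := congrArg (fun m : ℕ => (m : ℤ)) hsum
      push_cast at h
      linarith
    rw [this, Int.natAbs_natCast]

/-! ### The sieve factor tends to its limit -/

/-- For all real `K, C`, `θ > 0`, `a > 0`, eventually in `N ∈ ℕ`, with
`E = e^{400/log N} (1 + 1/(N^{1/8} − 1))⁸`:  `E K + (3/8) E C (a log N)^{−1/3} ≤ K + θ`.
[folklore] -/
theorem eventually_switchedSieveFactor_le (K C : ℝ) {θ a : ℝ} (hθ : 0 < θ) (ha : 0 < a) :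
    ∀ᶠ N : ℕ in atTop,
      Real.exp (400 / Real.log N) * (1 + 1 / ((N : ℝ) ^ (1 / 8 : ℝ) - 1)) ^ 8 * K +
        3 / 8 * (Real.exp (400 / Real.log N) * (1 + 1 / ((N : ℝ) ^ (1 / 8 : ℝ) - 1)) ^ 8) * C *
          (a * Real.log N) ^ (-(1 / 3 : ℝ)) ≤ K + θ := by
  have h1 : Tendsto (fun X : ℝ => 400 / Real.log X) atTop (𝓝 0) :=
    tendsto_const_nhds.div_atTop Real.tendsto_log_atTop
  have h2 : Tendsto (fun X : ℝ => Real.exp (400 / Real.log X)) atTop (𝓝 1) := by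
    have h := (Real.continuous_exp.tendsto 0).comp h1
    rw [Real.exp_zero] at h
    exact h
  have h3 : Tendsto (fun X : ℝ => (a * Real.log X) ^ (-(1 / 3 : ℝ))) atTop (𝓝 0) :=
    (tendsto_rpow_neg_atTop (by norm_num : (0 : ℝ) < 1 / 3)).comp
      (Real.tendsto_log_atTop.const_mul_atTop ha)
  have h4 : Tendsto (fun X : ℝ => (1 + 1 / (X ^ (1 / 8 : ℝ) - 1)) ^ 8) atTop (𝓝 ((1 + 0) ^ 8)) := by
    refine ((tendsto_const_nhds.add ?_).pow 8)
    have h := (tendsto_rpow_atTop (by norm_num : (0 : ℝ) < 1 / 8))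
    have h' : Tendsto (fun X : ℝ => X ^ (1 / 8 : ℝ) - 1) atTop atTop :=
      tendsto_atTop_add_const_right _ (-1) h
    have h'' := h'.inv_tendsto_atTop
    refine h''.congr fun X => ?_
    simp only [Pi.inv_apply, one_div]
  simp only [add_zero, one_pow] at h4
  have h5 : Tendsto (fun X : ℝ => Real.exp (400 / Real.log X) * (1 + 1 / (X ^ (1 / 8 : ℝ) - 1)) ^ 8)
      atTop (𝓝 (1 * 1)) := h2.mul h4
  rw [one_mul] at h5
  have h6 : Tendsto (fun X : ℝ =>
      Real.exp (400 / Real.log X) * (1 + 1 / (X ^ (1 / 8 : ℝ) - 1)) ^ 8 * K +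
        3 / 8 * (Real.exp (400 / Real.log X) * (1 + 1 / (X ^ (1 / 8 : ℝ) - 1)) ^ 8) * C *
          (a * Real.log X) ^ (-(1 / 3 : ℝ))) atTop (𝓝 (1 * K + 3 / 8 * 1 * C * 0)) :=
    (h5.mul_const K).add (((h5.const_mul (3 / 8)).mul_const C).mul h3)
  simp only [one_mul, mul_one, mul_zero, add_zero] at h6
  have h7 := h6.comp tendsto_natCast_atTop_atTop
  have h8 := h7.eventually_le_const (show K < K + θ by linarith)
  filter_upwards [h8] with N hN
  simpa using hN

/-! ### The sieve step -/

set_option maxHeartbeats 400000 in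
/-- **The sieve step of Nathanson's Theorem 10.6** (pp. 288–289, for `B = {N − p₁p₂p₃}`): for
`0 < ε ≤ 1`, `0 < δ ≤ 1/8`, `θ > 0` and all large even `N`, with `z = N^{1/8}`, `y = N^{1/3}`,
`V = sieveProduct N`,

`S(B, 𝒫, y) ≤ (e^γ/(2(1 − 2δ)) + θ) · #T̃(N, ε) · V(z) + R(N, ε, N^{1/2−δ})`.

Proof: `S(B, 𝒫, y) ≤ S(𝒜̃, P(y); N)` (`B ⊆ B̃`); the uniform linear-sieve upper bound
(`LinearSieve.upper_explicit`, level `D = N^{1/2−δ}`, dimension `Ω(1, L₀)` of `1/φ` off `N`) gives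
`S ≤ #T̃ · V(y) (2e^γ/s + C(log D)^{−1/3}) + R`, `s = log D/log y = 3(1/2 − δ)`; and
`V(y) · 2e^γ/s ≤ E V(z) (log z/log y)(2e^γ log y/log D) = E e^γ/(2(1−2δ)) V(z)` with
`E = e^{400/log N}(1 + 1/(z−1))⁸ → 1` (`sieveProduct_le_mul_of_le`), `V(y) ≤ (3/8) E V(z)`.
(Nathanson: level `N^{1/2}(log N)^{−6}`, `s = 3/2 + o(1)`, `F(s) = 4e^γ/3 + o(1)`,
`V(y)/V(z) = 3/8 + o(1)`, constant `e^γ/2 + O(ε)`.)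
[cite: Nathanson1996, Thm 10.6 (proof, pp. 288–289)] -/
theorem switchedSiftedCount_le {ε δ θ : ℝ} (hε : 0 < ε) (hε1 : ε ≤ 1) (hδ : 0 < δ)
    (hδ1 : δ ≤ 1 / 8) (hθ : 0 < θ) :
    ∀ᶠ N : ℕ in atTop, Even N →
      (switchedSiftedCount N (z N) (y N) : ℝ) ≤
        (Real.exp Real.eulerMascheroniConstant / (2 * (1 - 2 * δ)) + θ) *
            #(switchedTriplesExt N ε) * sieveProduct N (z N) +
          switchedRemainderExt N ε ((N : ℝ) ^ (1 / 2 - δ)) := by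
  -- the uniform linear sieve, for the dimension class `Ω(1, L₀)`
  obtain ⟨CI, hCI⟩ := LinearSieve.upper_explicit (54 * Real.exp (54 / Real.log 2))
  set G := Real.exp Real.eulerMascheroniConstant with hG
  have hG0 : 0 < G := Real.exp_pos _
  set K := G / (2 * (1 - 2 * δ)) with hK
  have h12δ : 0 < 1 - 2 * δ := by linarith
  have hK0 : 0 ≤ K := by positivity
  have ha : 0 < 1 / 2 - δ := by linarith
  filter_upwards [eventually_ge_atTop (3 ^ 8),
    eventually_switchedSieveFactor_le K (max CI 0) hθ ha] with N hN hfac hEven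
  -- basic quantities
  have hNpos : 0 < N := by omega
  have hN0 : N ≠ 0 := by omega
  have hN1 : (1 : ℝ) < N := by exact_mod_cast (show 1 < N by omega)
  have hN0' : (0 : ℝ) < N := by linarith
  have hlogN : 0 < Real.log N := Real.log_pos hN1
  set zr : ℝ := z N with hzr
  have hzr_def : zr = (N : ℝ) ^ (1 / 8 : ℝ) := rfl
  have hzr3 : 3 ≤ zr := by
    rw [hzr_def, show (3 : ℝ) = ((3 : ℝ) ^ (8 : ℕ)) ^ (1 / 8 : ℝ) by
      rw [← Real.rpow_natCast, ← Real.rpow_mul (by norm_num)]; norm_num]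
    exact Real.rpow_le_rpow (by norm_num) (by exact_mod_cast hN) (by norm_num)
  have hzr2 : 2 ≤ zr := by linarith
  have hlogzr : Real.log zr = 1 / 8 * Real.log N := Real.log_rpow hN0' _
  have hz8 : (N : ℝ) ≤ zr ^ 8 := by
    rw [hzr_def, ← Real.rpow_natCast, ← Real.rpow_mul hN0'.le]
    norm_num
  set Y : ℝ := y N with hY
  have hY_def : Y = (N : ℝ) ^ (1 / 3 : ℝ) := rfl
  have hzY : zr ≤ Y := Real.rpow_le_rpow_of_exponent_le hN1.le (by norm_num)
  have hY2 : 2 ≤ Y := by linarith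
  have hlogY : Real.log Y = 1 / 3 * Real.log N := Real.log_rpow hN0' _
  have hlogY0 : 0 < Real.log Y := by rw [hlogY]; positivity
  set D : ℝ := (N : ℝ) ^ (1 / 2 - δ) with hD
  have hlogD : Real.log D = (1 / 2 - δ) * Real.log N := Real.log_rpow hN0' _
  have hlogD0 : 0 < Real.log D := by rw [hlogD]; positivity
  have hYD : Y ≤ D := Real.rpow_le_rpow_of_exponent_le hN1.le (by linarith)
  have hs3 : Real.log D / Real.log Y ≤ 3 := by
    rw [div_le_iff₀ hlogY0, hlogD, hlogY]
    nlinarith [mul_nonneg hδ.le hlogN.le]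
  -- the sieve inequality for `𝒜̃`
  set A := switchedSeqExt N ε with hA
  have hdim : HasIwaniecDimension A.density 1 (54 * Real.exp (54 / Real.log 2)) :=
    hasIwaniecDimension_shiftedPrimesDensity hEven
  have hsize : (0 : ℝ) ≤ A.size N := Nat.cast_nonneg _
  have hI := hCI A hdim N D Y hY2 hYD hs3 hsize
  -- identify the terms
  have hsift : (switchedSiftedCount N (z N) (y N) : ℝ) ≤ A.sifted N (primesProdBelow Y) := by
    rw [hA, hY, sifted_switchedSeqExt_eq hε hε1]
    exact_mod_cast switchedSiftedCount_le_card hε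
  have hsizeq : A.size N = #(switchedTriplesExt N ε) := rfl
  have hVq : A.densityProduct (primesProdBelow Y) = sieveProduct N Y :=
    densityProduct_switchedSeqExt_eq N ε Y
  have hRq : ∑ d ∈ (Finset.range ⌈D⌉₊).filter (· ∣ primesProdBelow Y), |A.remainder d N| =
      switchedRemainderExt N ε D := by
    rw [hA, hY]
    exact sum_abs_remainder_switchedSeqExt_eq hε hε1 D
  rw [hsizeq, hVq, hRq, hlogD] at hI
  -- the main term
  have hT0 : 0 ≤ (#(switchedTriplesExt N ε) : ℝ) := Nat.cast_nonneg _
  have hVy0 : 0 ≤ sieveProduct N Y := (sieveProduct_mem_Icc hEven Y).1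
  have hVz0 : 0 ≤ sieveProduct N zr := (sieveProduct_mem_Icc hEven zr).1
  set E : ℝ := Real.exp (400 / Real.log N) * (1 + 1 / ((N : ℝ) ^ (1 / 8 : ℝ) - 1)) ^ 8 with hE
  have hE0 : 0 ≤ E := by
    have : 0 ≤ 1 / ((N : ℝ) ^ (1 / 8 : ℝ) - 1) := by
      rw [← hzr_def]; exact div_nonneg zero_le_one (by linarith)
    positivity
  have hρle : 1 / 8 * Real.log N / Real.log Y ≤ 3 / 8 := by
    rw [hlogY, div_le_iff₀ (by positivity)]
    nlinarith
  have hr0 : 0 ≤ ((1 / 2 - δ) * Real.log N) ^ (-(1 / 3 : ℝ)) := Real.rpow_nonneg (by positivity) _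
  have hF0 : 0 ≤ 2 * G / ((1 / 2 - δ) * Real.log N / Real.log Y) := by positivity
  have hVyle : sieveProduct N Y ≤ sieveProduct N zr * (1 / 8 * Real.log N / Real.log Y * E) := by
    have h := sieveProduct_le_mul_of_le hEven hN0 hzr2 hzY hz8
    rw [hlogzr] at h
    have h50 : (50 : ℝ) / (1 / 8 * Real.log N) = 400 / Real.log N := by
      rw [div_mul_eq_div_div]
      norm_num
    rw [h50] at h
    refine h.trans (le_of_eq ?_)
    rw [hE, hzr_def]
    ring
  have hρF : 1 / 8 * Real.log N / Real.log Y * (2 * G / ((1 / 2 - δ) * Real.log N / Real.log Y)) = K := by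
    rw [hK]
    field_simp
    ring
  have hmain := sieve_mainTerm_algebra (C := CI) hT0 hVz0 hVy0 hE0 hρle hr0 hF0 hVyle hρF hfac
  -- conclude
  calc (switchedSiftedCount N (z N) (y N) : ℝ) ≤ A.sifted N (primesProdBelow Y) := hsift
    _ ≤ (#(switchedTriplesExt N ε) : ℝ) * sieveProduct N Y *
          (2 * G / ((1 / 2 - δ) * Real.log N / Real.log Y) +
            CI * ((1 / 2 - δ) * Real.log N) ^ (-(1 / 3 : ℝ))) + switchedRemainderExt N ε D := hI
    _ ≤ (#(switchedTriplesExt N ε) : ℝ) * sieveProduct N zr * (K + θ) +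
          switchedRemainderExt N ε D := by linarith
    _ = (K + θ) * #(switchedTriplesExt N ε) * sieveProduct N zr + switchedRemainderExt N ε D := by
        ring

end Literature.NumberTheory.Sieve.Chen
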